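import Summits.BirchSwinnertonDyer.BirchSwinnertonDyer.Theorems.RamifiedHeegnerPairRamifiedPairUpperBoundRankOneMemberIrreducible
import Summits.BirchSwinnertonDyer.BirchSwinnertonDyer.Theorems.RamifiedHeegnerPairLeafRankOneUpperAtThreeOfSigma
import Summits.BirchSwinnertonDyer.BirchSwinnertonDyer.Theorems.KatoDescentTamePotSupersingularTameUpperHeegnerTwist
import Literature.NumberTheory.EllipticCurves.NonvanishingTwistsPrescribedSplitting
import Literature.NumberTheory.EllipticCurves.HeegnerPointsRationalityProofs
import Literature.NumberTheory.EllipticCurves.HeegnerPointsClassesProofs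
import Literature.NumberTheory.EllipticCurves.HeegnerPointsProofs
import Literature.NumberTheory.EllipticCurves.RootNumberEvenAnalyticRankProofs
import Literature.NumberTheory.EllipticCurves.ComplexMultiplicationHasCMProofs
import Literature.NumberTheory.EllipticCurves.NonEisensteinPrimeOfSurjective
import HarnessLib

/-!
# Crux X₄ `TprimeHeegnerUpperOfManinUnit` (stmt-BirchSwinnertonDyer-23738; TQMP r4 / TQS r303), registered line
# `rows_of_manin_unit` (05f83a59): the two IRREDUCIBLE-image research stubs r₁ `stub_ontoRowsOfManinUnit` and
# r₂ `stub_smallImageIrreducibleRowsOfManinUnit` have ONE common open core — Σ-form global `3`-divisibility of the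
# derived Heegner points to depth `ord₃ ∏_ℓ c_ℓ(E)` (the Manin unit spent) — plus the (t′) rank-ZERO lower half; on the
# Tamagawa-free rows Σ is vacuous and both stubs follow from PRINT + that lower half, image-free

HONEST FRAMING. Theorems only; helper file (`--supports stmt-BirchSwinnertonDyer-23738 --as helper`, leafhand
`leafhand-bsd-tamequarticmaninpa-3` g0, 2026-08-31); no definition, no named fact, no `sorry`; nothing is booked, no stub is
closed BY NAME, no item is closed, BSD is proved for no curve; CONDITIONAL on every displayed input. The registered skeleton
cuts the crux into the reduction to an optimal datum (p-stub) and three research stubs on the optimal rows split by the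
image of `ρ̄_{E,3}`, each CONSUMING the Manin unit `3 ∤ c(D)` of 23736 / 23737. This file is the (t′) twin of the Gss2
leaf's `RamifiedHeegnerPairLeafRankOneUpperAtThreeOfSigma.lean` (p607279) for the two IRREDUCIBLE-image stubs:

* §1 `tprime_twist_of_heegner` — the Heegner twist of a NON-CM (t′) row is a NON-CM (t′) row with the same `j`
  (KT's public `subTprime_twist_of_heegner` + `hasCM_iff_of_j_eq`).
* §2 `upper_three_of_irreducible_of_globalDivisibility_of_twistLower` — GENERIC additive `3`, `E[3]` IRREDUCIBLE, non-CM,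
  `r_an = 1`, ONE split Heegner datum with odd `d_K` and `L(E^{(d_K)},1) ≠ 0`: global `3^{s′}`-divisibility of the derived
  Heegner points to depth `ord₃ ∏_ℓ c_ℓ(E) + v₃(c(Dt))` (DISPLAYED research input) + Matar–Nekovář 2019 Thm. 0.7/§0.11
  (named fact; IRREDUCIBILITY only, no surjectivity) + the twist's LOWER half + print ⟹ `Typed.MissingUpperBoundAt W 3`
  (p607279's receptacle with its leaf binder `SubGss W 3` replaced by the one consequence used, `E[3]` irreducible).
* §3 `tprime_upper_three_of_irreducible_of_sigmaAtDatum_of_lowerRankZero` — on a non-CM (t′) row with `E[3]` irreducible and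
  ONE datum `Dt` at level `N_E`, the field is CHOSEN (Friedberg–Hoffstein Thm. B, `2` and every `ℓ ∣ N_E` split), the Heegner
  datum and the `K`-rational Heegner point of `Dt` are tree theorems, the twist is a non-CM (t′) rank-ZERO row (§1) whose
  lower half is the class input `hL0`; Σ AT `Dt` gives the upper half. `…_tamFree_…`: with `3 ∤ ∏_ℓ c_ℓ(E)` and `3 ∤ c(Dt)`
  the depth is `0` and Σ is VACUOUS: PUB + L0 suffice.
* §4 THE TWO REGISTERED STUBS MODULO DISPLAYED INPUTS, signatures VERBATIM as conclusions (r₁, r₂ ⟸ PUB + Σ to depth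
  `ord₃ ∏_ℓ c_ℓ` — the stub's `3 ∤ c(D)` IS what removes `v₃(c)` from the depth — + L0), and (§5) the Tamagawa-free rows of both
  from PUB + KT's 19981 at `3` alone. The surjectivity binder of r₁ is used only through irreducibility; the `¬ onto` binder of r₂ is idle.
* §5 L0 BY NAME: route KT's EXISTING item `KatoDescentTamePotSupersingular.TameLowerHalfRankZero` (19981) read at `p = 3`.

WHAT THIS SAYS ABOUT THE LINE. r₁ and r₂ are ONE problem (Matar–Nekovář's irreducible structure theorem is a tree named fact,
so the onto / normaliser split is not load-bearing); their open core is Σ (Jetchev's Conj. 1.3 Σ-form at the additive `3` —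
NOT in print: Jetchev 2008 Thm. 1.4 has `p ∤ N`) plus the (t′) rank-ZERO LOWER half (KT 19981 @ 3 / TQS 21391's K1, open). The
reducible stub r₃ is untouched. Census: `Cruxes/TprimeHeegnerUpperOfManinUnit/CENSUS-leafhand-tamequarticmaninpa-3-g0.md`.

References: [cite: MatarNekovar2019, Thm. 0.7, §0.11] [cite: Jetchev2008, Conj. 1.3, Thm. 1.4, Cor. 1.5] [cite: FriedbergHoffstein1995,
Thm. B] [cite: GrossZagier1986, Thm. I.(6.3), (7.3)] [cite: McCallumLMS1991, §5 Cor. 5.6] [cite: Miller2011LMS, Def. 1.1].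
-/

-- D-0017: single-problem summit, so `Summit.BirchSwinnertonDyer.BirchSwinnertonDyer.…` repeats a namespace BY DESIGN.
set_option linter.dupNamespace false
set_option autoImplicit false

noncomputable section

open scoped Classical NumberField
open WeierstrassCurve IsDedekindDomain NumberField Literature Literature.NumberTheory.EllipticCurves
  Literature.NumberTheory.EllipticCurves.ModularForms
  Literature.NumberTheory.EllipticCurves.Rank1Residual
  Literature.NumberTheory.EllipticCurves.Rank1Residual.Typed
  Literature.NumberTheory.EllipticCurves.KrizLi2019
  Literature.NumberTheory.QuadraticFields
  Summit.BirchSwinnertonDyer.Rank1Residual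
  Summit.BirchSwinnertonDyer.Rank1Residual.Additive
  Summit.BirchSwinnertonDyer.Rank1Residual.X11b
  Summit.BirchSwinnertonDyer.Rank1Residual.X11b.Three
  Summit.BirchSwinnertonDyer.BirchSwinnertonDyer.Theorems
  Summit.BirchSwinnertonDyer.BirchSwinnertonDyer.Theorems.SchneiderFree
  Summit.BirchSwinnertonDyer.BirchSwinnertonDyer.Theorems.RamifiedPairUpperBound

namespace Summit.BirchSwinnertonDyer.BirchSwinnertonDyer.Theorems.TprimeHeegnerUpperOfManinUnit

/-! ## §1 The Heegner twist of a non-CM (t′) row is a non-CM (t′) row -/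

/-- **The Heegner twist of a NON-CM (t′) row at `3` is a NON-CM (t′) row at `3` with the same `j`.** For `W/ℚ`
globally minimal, non-CM, additive of type (t′) at `3`, `K` imaginary quadratic of ODD discriminant with the Heegner
hypothesis for `N_E`, every globally minimal model `Wd` of `E^{(d_K)}` is non-CM, additive of type (t′) at `3`, and
`j(Wd) = j(E)` (KT's `subTprime_twist_of_heegner`; CM is read off `j`, `hasCM_iff_of_j_eq`). [folklore]
[cite: SilvermanATAEC1994, IV.9.4 (PDF pp. 344–346)] [cite: SilvermanAEC2009, X.5 Cor. 5.4 and III.1 Prop. 1.4(b)] -/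
theorem tprime_twist_of_heegner (W : WeierstrassCurve ℚ) [W.IsElliptic] [W.IsGloballyMinimal]
    (hCM : ¬ W.HasCM) (hadd : Addv W 3) (hT : SubTprime W 3)
    (K : Type) [Field K] [NumberField K] (hK : IsImaginaryQuadratic K)
    (hHN : SatisfiesHeegnerHypothesis (W.conductorNorm ℤ) K) (hodd : Odd (NumberField.discr K))
    (Wd : WeierstrassCurve ℚ) [Wd.IsElliptic] [Wd.IsGloballyMinimal] (Cd : VariableChange ℚ)
    (hWd : Cd • W.quadraticTwist (NumberField.discr K : ℚ) = Wd) :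
    ¬ Wd.HasCM ∧ Addv Wd 3 ∧ SubTprime Wd 3 ∧ Wd.j = W.j := by
  obtain ⟨haddd, hTd, hj⟩ := subTprime_twist_of_heegner W 3 hadd hT K hK hHN hodd Wd Cd hWd
  exact ⟨fun h ↦ hCM ((hasCM_iff_of_j_eq hj).mp h), haddd, hTd, hj⟩

/-! ## §2 Generic additive `3`, `E[3]` irreducible: the upper half at `W` from global divisibility at ONE split
Heegner datum, Matar–Nekovář, and the twist's lower half -/

/-- **The rank-ONE upper half at an additive `3` under IRREDUCIBILITY only, from Σ at one datum.** Data: `W/ℚ` globally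
minimal, NON-CM, additive at `3`, `E[3]` irreducible, `r_an(W) = 1`; ONE Heegner datum at level `N_E` over an imaginary
quadratic `K` with ODD `d_K` and the classical Heegner hypothesis (so `3 ∣ N_E` splits: `d_K ∉ {−3, −4}`, `d_K < −4`),
`L(W^{(d_K)},1) ≠ 0`, `P = y_K` the Heegner point of `Dt`, a globally minimal model `Wd` of the twist. NAMED FACTS
(hypotheses): `hGZ`, `hKo`, `hGZK`, `hmod`, `hGZ73`, Matar–Nekovář 2019 Thm 0.7/§0.11 `hMN`. RESEARCH INPUT `hglob`:
every derived Heegner point `P_n` on the frame `(Dt, H.β, ι)` (square-free `n` of Kolyvagin primes of index `≥ s′`) is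
`3^{s′}`-divisible for all `s′ ≤ ord₃ ∏_ℓ c_ℓ(W) + v₃(c(Dt))` (Jetchev's Σ-form at the additive `3`). TYPED INPUT
`hlow : Typed.MissingLowerBoundAt Wd 3`. OUTPUT: `Typed.MissingUpperBoundAt W 3` (receptacle
`upper_of_globalDivisibility_of_irreducible` ⟹ socket `IndexUpperBoundLeAt W 3 K P (v₃ c)`; Gross–Zagier ⟹ `P` non-torsion;
`missingUpperBoundAt_three_of_rankOne_addv_of_upperSocket_of_twistLower`).
[cite: MatarNekovar2019, Thm. 0.7 (p. 456) and §0.11 (p. 457)] [cite: Jetchev2008, Conj. 1.3 and Cor. 1.5 (p. 812)]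
[cite: GrossZagier1986, Thm. I.(6.3) and (7.3)] [cite: Miller2011LMS, Def. 1.1] -/
theorem upper_three_of_irreducible_of_globalDivisibility_of_twistLower
    (hGZ : ∀ (N : ℕ) [NeZero N] (W : WeierstrassCurve ℚ) (K : Type) [Field K] [NumberField K],
      gross_zagier N W K)
    (hKo : ∀ (N : ℕ) [NeZero N] (W : WeierstrassCurve ℚ) (K : Type) [Field K] [NumberField K],
      kolyvagin N W K)
    (hGZK : rank_eq_analyticRank_of_analyticRank_le_one) (hmod : hasEntireLFunction_rat)
    (hGZ73 : GrossZagier1986_thm_I_7_3)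
    (hMN : MatarNekovar2019.thm07_padicValNat_card_sha_primary_add_le_of_globalDivisibility_of_irreducible)
    (W : WeierstrassCurve ℚ) [W.IsElliptic] [W.IsGloballyMinimal] [NeZero (W.conductorNorm ℤ)]
    (hCM : ¬ W.HasCM) (hadd : Addv W 3) (hirr : W.HasIrreducibleModPGaloisRep 3) (hr : W.analyticRank = 1)
    (K : Type) [Field K] [NumberField K]
    (Dt : ModularParametrizationData W (W.conductorNorm ℤ))
    (H : HeegnerDatum (W.conductorNorm ℤ) (NumberField.discr K)) (ι : K →+* ℂ)
    (P : (W.baseChange K).toAffine.Point) (Wd : WeierstrassCurve ℚ) [Wd.IsElliptic] [Wd.IsGloballyMinimal]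
    (hK : IsImaginaryQuadratic K) (hodd : Odd (NumberField.discr K))
    (hHH : SatisfiesHeegnerHypothesis (W.conductorNorm ℤ) K)
    (hLd : (W.quadraticTwist (NumberField.discr K : ℚ)).entireLFunction 1 ≠ 0)
    (hP : WeierstrassCurve.Affine.Point.map ι.toRatAlgHom P = heegnerPointComplex Dt H)
    (hC : ∃ C : WeierstrassCurve.VariableChange ℚ, C • W.quadraticTwist (NumberField.discr K : ℚ) = Wd)
    (hglob : ∀ (s' : ℕ), s' ≤ padicValNat 3 W.tamagawaProduct + padicValNat 3 Dt.c.natAbs →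
      ∀ (n : ℕ) (d : KolyvaginHeegnerData Dt H.β ι n), Squarefree n →
        (∀ ℓ ∈ n.primeFactors, Zhang2014.IsKolyvaginPrime (W.conductorNorm ℤ) W K 3 ℓ ∧
          s' ≤ Zhang2014.kolyvaginIndex W 3 ℓ) → Koly.PDiv d 3 s')
    (hlow : MissingLowerBoundAt Wd 3) :
    MissingUpperBoundAt W 3 := by
  -- `3 ∣ N_E` splits in `K`: `d_K ≠ -3`; `d_K` odd: `d_K ≠ -4`; hence `d_K < -4`
  have h3N : 3 ∣ W.conductorNorm ℤ :=
    (W.dvd_conductorNorm_iff_not_hasGoodReductionAtPrime 3).mpr (not_good_of_addv W 3 hadd)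
  have h3 : NumberField.discr K ≠ -3 := by
    intro h
    exact (X11b.Three.not_dvd_discr_and_not_dvd_torsionOrder_of_heegner hK hHH (by decide) h3N).1
      (h ▸ ⟨-1, by norm_num⟩)
  have h4 : NumberField.discr K ≠ -4 := by
    intro h
    rw [h] at hodd
    exact (Int.not_odd_iff_even.mpr ⟨-2, by norm_num⟩) hodd
  have hd4 : NumberField.discr K < -4 := by
    haveI : IsTotallyComplex K := hK.2
    have hneg : NumberField.discr K < 0 := WeierstrassCurve.discr_neg_of_finrank_eq_two K hK.1
    have hmod4 := Literature.NumberTheory.QuadraticFields.Quadratic.discr_emod_four (K := K) hK.1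
    rcases hodd with ⟨k, hk⟩
    omega
  -- the Heegner point is non-torsion (Gross–Zagier: `L′(E/K,1) = L′(E,1)·L(E^{(d_K)},1) ≠ 0`)
  have hL0 : W.entireLFunction 1 = 0 := entireLFunction_one_eq_zero_of_analyticRank_eq_one hr
  obtain ⟨-, hderiv⟩ := leadingLCoeff_eq_deriv_of_analyticRank_eq_one hr
  have hLK : LDerivEK W K ≠ 0 := by
    rw [lDerivEK_eq_deriv_mul W K hmod hL0]; exact mul_ne_zero hderiv hLd
  have hnt : ¬ IsOfFinAddOrder P :=
    (lDerivEK_ne_zero_iff_not_isOfFinAddOrder W (W.conductorNorm ℤ) K (hGZ _ W K) hK hHH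
      ⟨Dt, H, ι, hP⟩).mp hLK
  -- the socket at slack `v₃(c)` from global divisibility under irreducibility, then p606327 §2
  have hup : Upper.IndexUpperBoundLeAt W 3 K P (padicValNat 3 Dt.c.natAbs) :=
    upper_of_globalDivisibility_of_irreducible hKo hMN W 3 (by decide) hCM hirr K hK h3 h4 hHH Dt H ι P hP
      hnt hglob
  exact missingUpperBoundAt_three_of_rankOne_addv_of_upperSocket_of_twistLower hGZ hKo hGZK hmod hGZ73 W hadd
    hr (W.conductorNorm ℤ) K Dt H ι P Wd rfl hK hodd hd4 hHH hLd hP hC hup hlow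

/-! ## §3 The (t′) rows with `E[3]` irreducible: the field CHOSEN, Σ at one datum, and the Tamagawa-free rows -/

/-- **The upper half on a non-CM (t′) rank-one row with `E[3]` IRREDUCIBLE, from Σ AT ONE PARAMETRISATION DATUM.**
For `W` globally minimal, non-CM, additive of type (t′) at `3`, `E[3]` irreducible, `r_an(W) = 1`, and a parametrisation
datum `Dt` at level `N_E`: IF for every imaginary quadratic `K` of odd discriminant with the Heegner hypothesis for `N_E`
and `L(W^{(d_K)},1) ≠ 0`, every Heegner datum `H`, `ι`, and the Heegner point `P` (non-torsion), the derived Heegner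
points on the frame `(Dt, H.β, ι)` are `3^{s′}`-divisible for all `s′ ≤ ord₃ ∏_ℓ c_ℓ(W) + v₃(c(Dt))` (`hSig`, Σ at `Dt`,
DISPLAYED), and every non-CM (t′) rank-ZERO curve at `3` has its lower half (`hL0`), THEN `Typed.MissingUpperBoundAt W 3`
— given the printed facts (field: Friedberg–Hoffstein, `2` and every `ℓ ∣ N_E` split, `w(W) = −1` by modularity; Heegner
datum and `K`-rational Heegner point of `Dt`: tree theorems; the minimal twist is a non-CM (t′) rank-`0` curve (§1); then §2).
[cite: FriedbergHoffstein1995, Thm. B] [cite: MatarNekovar2019, Thm. 0.7 (p. 456)] [cite: Jetchev2008, Conj. 1.3]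
[cite: GrossZagier1986, Thm. I.(6.3) and (7.3)] [cite: Miller2011LMS, Def. 1.1] -/
theorem tprime_upper_three_of_irreducible_of_sigmaAtDatum_of_lowerRankZero
    (hGZ : ∀ (N : ℕ) [NeZero N] (W : WeierstrassCurve ℚ) (K : Type) [Field K] [NumberField K],
      gross_zagier N W K)
    (hKo : ∀ (N : ℕ) [NeZero N] (W : WeierstrassCurve ℚ) (K : Type) [Field K] [NumberField K],
      kolyvagin N W K)
    (hGZK : rank_eq_analyticRank_of_analyticRank_le_one) (hmod : hasEntireLFunction_rat)
    (hGZ73 : GrossZagier1986_thm_I_7_3)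
    (hMN : MatarNekovar2019.thm07_padicValNat_card_sha_primary_add_le_of_globalDivisibility_of_irreducible)
    (hnf : exists_isNewformOf) (hFH : friedbergHoffstein_exists_heegnerField_splitDivisors_twist_ne_zero)
    (hL0 : ∀ (V : WeierstrassCurve ℚ) [V.IsElliptic] [V.IsGloballyMinimal],
      ¬ V.HasCM → Addv V 3 → SubTprime V 3 → V.analyticRank = 0 → MissingLowerBoundAt V 3)
    (W : WeierstrassCurve ℚ) [W.IsElliptic] [W.IsGloballyMinimal] [NeZero (W.conductorNorm ℤ)]
    (hCM : ¬ W.HasCM) (hadd : Addv W 3) (hT : SubTprime W 3) (hirr : W.HasIrreducibleModPGaloisRep 3)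
    (hr : W.analyticRank = 1) (Dt : ModularParametrizationData W (W.conductorNorm ℤ))
    (hSig : ∀ (K : Type) [Field K] [NumberField K]
      (H : HeegnerDatum (W.conductorNorm ℤ) (NumberField.discr K)) (ι : K →+* ℂ) (P : (W.baseChange K).toAffine.Point),
      IsImaginaryQuadratic K → SatisfiesHeegnerHypothesis (W.conductorNorm ℤ) K →
      (W.quadraticTwist (NumberField.discr K : ℚ)).entireLFunction 1 ≠ 0 →
      WeierstrassCurve.Affine.Point.map ι.toRatAlgHom P = heegnerPointComplex Dt H → ¬ IsOfFinAddOrder P →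
      Odd (NumberField.discr K) →
      ∀ (s' : ℕ), s' ≤ padicValNat 3 W.tamagawaProduct + padicValNat 3 Dt.c.natAbs →
      ∀ (n : ℕ) (d : KolyvaginHeegnerData Dt H.β ι n), Squarefree n →
      (∀ ℓ ∈ n.primeFactors, Zhang2014.IsKolyvaginPrime (W.conductorNorm ℤ) W K 3 ℓ ∧
        s' ≤ Zhang2014.kolyvaginIndex W 3 ℓ) → Koly.PDiv d 3 s') :
    MissingUpperBoundAt W 3 := by
  -- the sign of the functional equation is `−1` (modularity, `r_an = 1`)
  have hw : W.rootNumber = -1 := by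
    rw [WeierstrassCurve.rootNumber_eq_neg_one_pow_analyticRank_of_exists_isNewformOf hnf W, hr]
    norm_num
  -- the Friedberg–Hoffstein field: every `ℓ ∣ N_E` and `ℓ = 2` split, `L(E^{(d_K)},1) ≠ 0`
  obtain ⟨K, _, _, hK, -, hHN, hH2, hLt⟩ := hFH W hw 2 two_ne_zero 4
  have hodd : Odd (NumberField.discr K) := by
    have h2 : ¬ ((2 : ℕ) : ℤ) ∣ NumberField.discr K :=
      Literature.SatisfiesHeegnerHypothesis.not_dvd_discr hK.1 hH2 Nat.prime_two (dvd_refl 2)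
    rw [← Int.not_even_iff_odd, even_iff_two_dvd]
    exact_mod_cast h2
  -- the Heegner datum and the `K`-rational Heegner point of `Dt`
  obtain ⟨β, hβ⟩ := exists_dvd_sq_sub_discr_holds (W.conductorNorm ℤ) K hK hHN
  obtain ⟨H, -⟩ := nonempty_heegnerDatum_holds (W.conductorNorm ℤ) K hK hβ
  obtain ⟨ι⟩ : Nonempty (K →+* ℂ) := inferInstance
  obtain ⟨P, hP⟩ := heegnerPointComplex_mem_range_map_holds (W.conductorNorm ℤ) W K hK hHN Dt H ι
  -- a globally minimal model of the twist: a non-CM (t′) curve of analytic rank `0`, so `hL0` applies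
  have hD0 : (NumberField.discr K : ℚ) ≠ 0 := by exact_mod_cast NumberField.discr_ne_zero K
  haveI hEt : (W.quadraticTwist (NumberField.discr K : ℚ)).IsElliptic := W.isElliptic_quadraticTwist hD0
  obtain ⟨Cd, hCd⟩ := hasGlobalMinimalModel_rat_holds (W.quadraticTwist (NumberField.discr K : ℚ))
  haveI : (Cd • W.quadraticTwist (NumberField.discr K : ℚ)).IsGloballyMinimal := hCd
  have hrd : (Cd • W.quadraticTwist (NumberField.discr K : ℚ)).analyticRank = 0 := by
    rw [analyticRank_smul]
    exact analyticRank_eq_zero_of_entireLFunction_one_ne_zero _ hLt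
  obtain ⟨hCMd, haddd, hTd, -⟩ := tprime_twist_of_heegner W hCM hadd hT K hK hHN hodd
    (Cd • W.quadraticTwist (NumberField.discr K : ℚ)) Cd rfl
  have hlow : MissingLowerBoundAt (Cd • W.quadraticTwist (NumberField.discr K : ℚ)) 3 :=
    hL0 _ hCMd haddd hTd hrd
  -- the Heegner point is non-torsion (Gross–Zagier), so Σ at this datum is available; §2 concludes
  have hL0W : W.entireLFunction 1 = 0 := entireLFunction_one_eq_zero_of_analyticRank_eq_one hr
  obtain ⟨-, hderiv⟩ := leadingLCoeff_eq_deriv_of_analyticRank_eq_one hr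
  have hLK : LDerivEK W K ≠ 0 := by
    rw [lDerivEK_eq_deriv_mul W K hmod hL0W]; exact mul_ne_zero hderiv hLt
  have hnt : ¬ IsOfFinAddOrder P :=
    (lDerivEK_ne_zero_iff_not_isOfFinAddOrder W (W.conductorNorm ℤ) K (hGZ _ W K) hK hHN
      ⟨Dt, H, ι, hP⟩).mp hLK
  exact upper_three_of_irreducible_of_globalDivisibility_of_twistLower hGZ hKo hGZK hmod hGZ73 hMN W hCM hadd hirr hr
    K Dt H ι P (Cd • W.quadraticTwist (NumberField.discr K : ℚ)) hK hodd hHN hLt hP ⟨Cd, rfl⟩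
    (fun s' hs' n d hn hℓ ↦ hSig K H ι P hK hHN hLt hP hnt hodd s' hs' n d hn hℓ) hlow

/-- **The TAMAGAWA-FREE (t′) rows with `E[3]` irreducible, IMAGE-FREE beyond irreducibility: PUB + L0.** For `W`
globally minimal, non-CM, additive of type (t′) at `3`, `E[3]` irreducible (onto OR normaliser image), `r_an(W) = 1`,
`3 ∤ ∏_ℓ c_ℓ(W)`, and a parametrisation datum at level `N_E` with `3 ∤ c`: the depth of Σ is `0` and `3⁰ ∣ P_n` is free,
so `Typed.MissingUpperBoundAt W 3` follows from the printed facts (Gross–Zagier, Kolyvagin, GZK, modularity, GZ I.7.3,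
Matar–Nekovář 2019 Thm. 0.7, newform, Friedberg–Hoffstein) and the LOWER half of the non-CM (t′) rank-zero curves at `3`.
[cite: MatarNekovar2019, Thm. 0.7 (p. 456) and §0.11 (p. 457)] [cite: FriedbergHoffstein1995, Thm. B]
[cite: GrossZagier1986, Thm. I.(6.3) and (7.3)] [cite: Miller2011LMS, Def. 1.1] -/
theorem tprime_upper_three_of_irreducible_tamFree_of_pub_of_lowerRankZero
    (hGZ : ∀ (N : ℕ) [NeZero N] (W : WeierstrassCurve ℚ) (K : Type) [Field K] [NumberField K],
      gross_zagier N W K)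
    (hKo : ∀ (N : ℕ) [NeZero N] (W : WeierstrassCurve ℚ) (K : Type) [Field K] [NumberField K],
      kolyvagin N W K)
    (hGZK : rank_eq_analyticRank_of_analyticRank_le_one) (hmod : hasEntireLFunction_rat)
    (hGZ73 : GrossZagier1986_thm_I_7_3)
    (hMN : MatarNekovar2019.thm07_padicValNat_card_sha_primary_add_le_of_globalDivisibility_of_irreducible)
    (hnf : exists_isNewformOf) (hFH : friedbergHoffstein_exists_heegnerField_splitDivisors_twist_ne_zero)
    (hL0 : ∀ (V : WeierstrassCurve ℚ) [V.IsElliptic] [V.IsGloballyMinimal],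
      ¬ V.HasCM → Addv V 3 → SubTprime V 3 → V.analyticRank = 0 → MissingLowerBoundAt V 3)
    (W : WeierstrassCurve ℚ) [W.IsElliptic] [W.IsGloballyMinimal] [NeZero (W.conductorNorm ℤ)]
    (hCM : ¬ W.HasCM) (hadd : Addv W 3) (hT : SubTprime W 3) (hirr : W.HasIrreducibleModPGaloisRep 3)
    (hr : W.analyticRank = 1) (htam : ¬ 3 ∣ W.tamagawaProduct)
    (Dt : ModularParametrizationData W (W.conductorNorm ℤ)) (hc : ¬ (3 : ℤ) ∣ Dt.c) :
    MissingUpperBoundAt W 3 := by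
  have ht0 : padicValNat 3 W.tamagawaProduct = 0 := padicValNat.eq_zero_of_not_dvd htam
  have hc0 : padicValNat 3 Dt.c.natAbs = 0 :=
    padicValNat.eq_zero_of_not_dvd fun h ↦ hc (Int.ofNat_dvd_left.mpr h)
  refine tprime_upper_three_of_irreducible_of_sigmaAtDatum_of_lowerRankZero hGZ hKo hGZK hmod hGZ73 hMN hnf hFH hL0
    W hCM hadd hT hirr hr Dt ?_
  intro K _ _ H ι P _ _ _ _ _ _ s' hs' n d _ _
  have hs0 : s' = 0 := by omega
  subst hs0
  exact koly_pDiv_zero d 3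

/-! ## §4 The two registered irreducible-image stubs of `rows_of_manin_unit`, modulo displayed inputs -/

/-- **r₁ `stub_ontoRowsOfManinUnit` ⟸ PUB + Σ + L0** (conclusion = the registered stub's signature VERBATIM). Σ is
displayed on the irreducible non-CM (t′) rank-one rows to depth `ord₃ ∏_ℓ c_ℓ(W)` — the stub's Manin unit `3 ∤ c(D)` is
exactly what removes `v₃(c)` from the depth —; L0 is the non-CM (t′) rank-ZERO lower half at `3`. The surjectivity binder
is used only through irreducibility. CONDITIONAL; closes nothing. [cite: MatarNekovar2019, Thm. 0.7 (p. 456)]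
[cite: Jetchev2008, Conj. 1.3 (p. 812)] [cite: FriedbergHoffstein1995, Thm. B] [cite: Miller2011LMS, Def. 1.1] -/
theorem ontoRowsOfManinUnit_of_pub_of_sigma_of_lowerRankZero
    (hGZ : ∀ (N : ℕ) [NeZero N] (W : WeierstrassCurve ℚ) (K : Type) [Field K] [NumberField K],
      gross_zagier N W K)
    (hKo : ∀ (N : ℕ) [NeZero N] (W : WeierstrassCurve ℚ) (K : Type) [Field K] [NumberField K],
      kolyvagin N W K)
    (hGZK : rank_eq_analyticRank_of_analyticRank_le_one) (hmod : hasEntireLFunction_rat)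
    (hGZ73 : GrossZagier1986_thm_I_7_3)
    (hMN : MatarNekovar2019.thm07_padicValNat_card_sha_primary_add_le_of_globalDivisibility_of_irreducible)
    (hnf : exists_isNewformOf) (hFH : friedbergHoffstein_exists_heegnerField_splitDivisors_twist_ne_zero)
    (hSig : ∀ (W : WeierstrassCurve ℚ) [W.IsElliptic] [W.IsGloballyMinimal] [NeZero (W.conductorNorm ℤ)]
      (K : Type) [Field K] [NumberField K] (Dt : ModularParametrizationData W (W.conductorNorm ℤ))
      (H : HeegnerDatum (W.conductorNorm ℤ) (NumberField.discr K)) (ι : K →+* ℂ) (P : (W.baseChange K).toAffine.Point),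
      ¬ W.HasCM → Addv W 3 → SubTprime W 3 → W.HasIrreducibleModPGaloisRep 3 → W.analyticRank = 1 →
      ¬ (3 : ℤ) ∣ Dt.c → IsImaginaryQuadratic K → SatisfiesHeegnerHypothesis (W.conductorNorm ℤ) K →
      (W.quadraticTwist (NumberField.discr K : ℚ)).entireLFunction 1 ≠ 0 →
      WeierstrassCurve.Affine.Point.map ι.toRatAlgHom P = heegnerPointComplex Dt H → ¬ IsOfFinAddOrder P →
      Odd (NumberField.discr K) →
      ∀ (s' : ℕ), s' ≤ padicValNat 3 W.tamagawaProduct →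
      ∀ (n : ℕ) (d : KolyvaginHeegnerData Dt H.β ι n), Squarefree n →
      (∀ ℓ ∈ n.primeFactors, Zhang2014.IsKolyvaginPrime (W.conductorNorm ℤ) W K 3 ℓ ∧
        s' ≤ Zhang2014.kolyvaginIndex W 3 ℓ) → Koly.PDiv d 3 s')
    (hL0 : ∀ (V : WeierstrassCurve ℚ) [V.IsElliptic] [V.IsGloballyMinimal],
      ¬ V.HasCM → Addv V 3 → SubTprime V 3 → V.analyticRank = 0 → MissingLowerBoundAt V 3) :
    ∀ (W : WeierstrassCurve ℚ) [W.IsElliptic] [W.IsGloballyMinimal] [NeZero (W.conductorNorm ℤ)],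
      ¬ W.HasCM → Rank1Residual.Addv W 3 → Summit.BirchSwinnertonDyer.Rank1Residual.Additive.SubTprime W 3 →
      W.HasSurjectiveModNGaloisRep 3 → W.analyticRank = 1 →
      ∀ (D : ModularParametrizationData W (W.conductorNorm ℤ)), ¬ (3 : ℤ) ∣ D.maninConstant →
        Rank1Residual.Typed.MissingUpperBoundAt W 3 := by
  intro W _ _ _ hCM hadd hT hsurj hr D hc
  have hirr : W.HasIrreducibleModPGaloisRep 3 :=
    hasIrreducibleModPGaloisRep_of_hasSurjectiveModNGaloisRep W 3 hsurj
  have hc' : ¬ (3 : ℤ) ∣ D.c := hc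
  have hc0 : padicValNat 3 D.c.natAbs = 0 :=
    padicValNat.eq_zero_of_not_dvd fun h ↦ hc' (Int.ofNat_dvd_left.mpr h)
  refine tprime_upper_three_of_irreducible_of_sigmaAtDatum_of_lowerRankZero hGZ hKo hGZK hmod hGZ73 hMN hnf hFH hL0
    W hCM hadd hT hirr hr D ?_
  intro K _ _ H ι P hK hHN hLt hP hnt hodd s' hs' n d hn hℓ
  exact hSig W K D H ι P hCM hadd hT hirr hr hc' hK hHN hLt hP hnt hodd s' (by omega) n d hn hℓ

/-- **r₂ `stub_smallImageIrreducibleRowsOfManinUnit` ⟸ PUB + Σ + L0** (conclusion = the registered stub's signature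
VERBATIM; SAME inputs as r₁: the `¬ onto` binder is idle, Matar–Nekovář's irreducible form replaces Kolyvagin's surjective
one). CONDITIONAL; closes nothing. [cite: MatarNekovar2019, Thm. 0.7 (p. 456) and §0.11 (p. 457)]
[cite: Jetchev2008, Conj. 1.3 (p. 812)] [cite: FriedbergHoffstein1995, Thm. B] [cite: Miller2011LMS, Def. 1.1] -/
theorem smallImageIrreducibleRowsOfManinUnit_of_pub_of_sigma_of_lowerRankZero
    (hGZ : ∀ (N : ℕ) [NeZero N] (W : WeierstrassCurve ℚ) (K : Type) [Field K] [NumberField K],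
      gross_zagier N W K)
    (hKo : ∀ (N : ℕ) [NeZero N] (W : WeierstrassCurve ℚ) (K : Type) [Field K] [NumberField K],
      kolyvagin N W K)
    (hGZK : rank_eq_analyticRank_of_analyticRank_le_one) (hmod : hasEntireLFunction_rat)
    (hGZ73 : GrossZagier1986_thm_I_7_3)
    (hMN : MatarNekovar2019.thm07_padicValNat_card_sha_primary_add_le_of_globalDivisibility_of_irreducible)
    (hnf : exists_isNewformOf) (hFH : friedbergHoffstein_exists_heegnerField_splitDivisors_twist_ne_zero)
    (hSig : ∀ (W : WeierstrassCurve ℚ) [W.IsElliptic] [W.IsGloballyMinimal] [NeZero (W.conductorNorm ℤ)]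
      (K : Type) [Field K] [NumberField K] (Dt : ModularParametrizationData W (W.conductorNorm ℤ))
      (H : HeegnerDatum (W.conductorNorm ℤ) (NumberField.discr K)) (ι : K →+* ℂ) (P : (W.baseChange K).toAffine.Point),
      ¬ W.HasCM → Addv W 3 → SubTprime W 3 → W.HasIrreducibleModPGaloisRep 3 → W.analyticRank = 1 →
      ¬ (3 : ℤ) ∣ Dt.c → IsImaginaryQuadratic K → SatisfiesHeegnerHypothesis (W.conductorNorm ℤ) K →
      (W.quadraticTwist (NumberField.discr K : ℚ)).entireLFunction 1 ≠ 0 →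
      WeierstrassCurve.Affine.Point.map ι.toRatAlgHom P = heegnerPointComplex Dt H → ¬ IsOfFinAddOrder P →
      Odd (NumberField.discr K) →
      ∀ (s' : ℕ), s' ≤ padicValNat 3 W.tamagawaProduct →
      ∀ (n : ℕ) (d : KolyvaginHeegnerData Dt H.β ι n), Squarefree n →
      (∀ ℓ ∈ n.primeFactors, Zhang2014.IsKolyvaginPrime (W.conductorNorm ℤ) W K 3 ℓ ∧
        s' ≤ Zhang2014.kolyvaginIndex W 3 ℓ) → Koly.PDiv d 3 s')
    (hL0 : ∀ (V : WeierstrassCurve ℚ) [V.IsElliptic] [V.IsGloballyMinimal],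
      ¬ V.HasCM → Addv V 3 → SubTprime V 3 → V.analyticRank = 0 → MissingLowerBoundAt V 3) :
    ∀ (W : WeierstrassCurve ℚ) [W.IsElliptic] [W.IsGloballyMinimal] [NeZero (W.conductorNorm ℤ)],
      ¬ W.HasCM → Rank1Residual.Addv W 3 → Summit.BirchSwinnertonDyer.Rank1Residual.Additive.SubTprime W 3 →
      W.HasIrreducibleModPGaloisRep 3 → ¬ W.HasSurjectiveModNGaloisRep 3 → W.analyticRank = 1 →
      ∀ (D : ModularParametrizationData W (W.conductorNorm ℤ)), ¬ (3 : ℤ) ∣ D.maninConstant →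
        Rank1Residual.Typed.MissingUpperBoundAt W 3 := by
  intro W _ _ _ hCM hadd hT hirr _ hr D hc
  have hc' : ¬ (3 : ℤ) ∣ D.c := hc
  have hc0 : padicValNat 3 D.c.natAbs = 0 :=
    padicValNat.eq_zero_of_not_dvd fun h ↦ hc' (Int.ofNat_dvd_left.mpr h)
  refine tprime_upper_three_of_irreducible_of_sigmaAtDatum_of_lowerRankZero hGZ hKo hGZK hmod hGZ73 hMN hnf hFH hL0
    W hCM hadd hT hirr hr D ?_
  intro K _ _ H ι P hK hHN hLt hP hnt hodd s' hs' n d hn hℓ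
  exact hSig W K D H ι P hCM hadd hT hirr hr hc' hK hHN hLt hP hnt hodd s' (by omega) n d hn hℓ

/-! ## §5 L0 by name: route KT's item 19981 read at `p = 3` -/

/-- **L0 BY NAME.** The non-CM (t′) rank-ZERO lower half at `3` used above is route `KatoDescentTamePotSupersingular`'s
EXISTING item `TameLowerHalfRankZero` (stmt-BirchSwinnertonDyer-19981: every odd tame potentially supersingular prime,
no CM binder) read at `p = 3`. CONDITIONAL on that item (open); closes nothing. [cite: Miller2011LMS, Def. 1.1] -/
theorem tprimeLowerRankZero_three_of_tameLowerHalfRankZero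
    (h : Summit.BirchSwinnertonDyer.BirchSwinnertonDyer.Theses.KatoDescentTamePotSupersingular.TameLowerHalfRankZero) :
    ∀ (V : WeierstrassCurve ℚ) [V.IsElliptic] [V.IsGloballyMinimal],
      ¬ V.HasCM → Addv V 3 → SubTprime V 3 → V.analyticRank = 0 → MissingLowerBoundAt V 3 :=
  fun V _ _ _ hadd hT hr ↦ h V 3 hr (by decide) hadd hT

/-- **The TAMAGAWA-FREE rows of BOTH irreducible-image stubs (r₁: `ρ̄` onto ⟹ irreducible; r₂: irreducible not onto)
from PRINT + KT's item 19981 at `3`, by name**: for `W` non-CM (t′) rank-one with `E[3]` irreducible, `3 ∤ ∏_ℓ c_ℓ(W)`, and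
a datum `D` at level `N_E` with `3 ∤ c(D)` (the stub's Manin unit), `Typed.MissingUpperBoundAt W 3`. On these rows the two
research stubs carry NO research beyond the rank-zero lower half. [cite: MatarNekovar2019, Thm. 0.7 (p. 456) and §0.11
(p. 457)] [cite: FriedbergHoffstein1995, Thm. B] [cite: GrossZagier1986, Thm. I.(6.3) and (7.3)] [cite: Miller2011LMS, Def. 1.1] -/
theorem irreducibleRowsOfManinUnit_tamFree_of_pub_of_tameLowerHalfRankZero
    (hGZ : ∀ (N : ℕ) [NeZero N] (W : WeierstrassCurve ℚ) (K : Type) [Field K] [NumberField K],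
      gross_zagier N W K)
    (hKo : ∀ (N : ℕ) [NeZero N] (W : WeierstrassCurve ℚ) (K : Type) [Field K] [NumberField K],
      kolyvagin N W K)
    (hGZK : rank_eq_analyticRank_of_analyticRank_le_one) (hGZ73 : GrossZagier1986_thm_I_7_3)
    (hMN : MatarNekovar2019.thm07_padicValNat_card_sha_primary_add_le_of_globalDivisibility_of_irreducible)
    (hnf : exists_isNewformOf) (hFH : friedbergHoffstein_exists_heegnerField_splitDivisors_twist_ne_zero)
    (hKT : Summit.BirchSwinnertonDyer.BirchSwinnertonDyer.Theses.KatoDescentTamePotSupersingular.TameLowerHalfRankZero) :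
    ∀ (W : WeierstrassCurve ℚ) [W.IsElliptic] [W.IsGloballyMinimal] [NeZero (W.conductorNorm ℤ)],
      ¬ W.HasCM → Rank1Residual.Addv W 3 → Summit.BirchSwinnertonDyer.Rank1Residual.Additive.SubTprime W 3 →
      W.HasIrreducibleModPGaloisRep 3 → W.analyticRank = 1 → ¬ 3 ∣ W.tamagawaProduct →
      ∀ (D : ModularParametrizationData W (W.conductorNorm ℤ)), ¬ (3 : ℤ) ∣ D.maninConstant →
        Rank1Residual.Typed.MissingUpperBoundAt W 3 :=
  fun W _ _ _ hCM hadd hT hirr hr htam D hc ↦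
    tprime_upper_three_of_irreducible_tamFree_of_pub_of_lowerRankZero hGZ hKo hGZK
      (hasEntireLFunction_rat_of_exists_isNewformOf hnf) hGZ73 hMN hnf hFH
      (tprimeLowerRankZero_three_of_tameLowerHalfRankZero hKT) W hCM hadd hT hirr hr htam D hc

end Summit.BirchSwinnertonDyer.BirchSwinnertonDyer.Theorems.TprimeHeegnerUpperOfManinUnit

end
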